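import Mathlib
import Summits.MatrixMultiplication.MatrixMultiplication.Theorems.FidelityWitnessesDiagonalPowerDecayConverseKeyInequality

/-!
# Converse of line `frame-negativity-singlet-fraction`, part II: the sub-unitary witness and the TRACE-NORM BOUND

Crux `FidelityWitnesses.DiagonalPowerDecay` (stmt-MatrixMultiplication-14053), lead prover-line-stmt-MatrixMultiplication-14053-0.
* `exists_subunitary_witness`: every `φ ∈ ℂ^n ⊗ ℂ^n` has a SUB-UNITARY `Ψ` (the matrix `conj Ψ` is a contraction) with
  `⟨Ψ, φ⟩ = ρ ≥ 0` and `‖(ptr X) φ‖² ≤ n ρ²` for all Hermitian contractions `X` — the Schmidt sum `ρ = Σ_j ‖row_j φ‖` in the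
  eigenbasis of `Φ Φᴴ` (no singular value decomposition needed: the rows are orthogonal there).
* `ptr_traceNorm_bound` (registered unfolded form `ptrTraceNormBound`): for `R ⪰ 0` with `Re⟨Ψ|R|Ψ⟩ ≤ M` on sub-unitary
  `Ψ` and any `θ > 0`: `ptr R = Y − Z`, `Y, Z ⪰ 0`, `tr Y + tr Z ≤ n √(t M/θ) + t √(n θ)` (`t = tr R`).  Proof: Jordan
  splitting, `Σ|λ_i| = Re tr(R K)` with `K = ptr (signOp)`, eigen-expansion `tr(R K) = Σ_i μ_i ⟨φ_i, K φ_i⟩`, split of the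
  `φ_i` by `ρ_i² ≥ θ`: HEAD by Cauchy–Schwarz in Frobenius norm (`‖K‖_F² ≤ n²`, `‖R_Λ‖_F² = Σ_Λ μ_i² ≤ t M/θ` because
  `μ_i ρ_i² ≤ Re⟨Ψ_i|R|Ψ_i⟩ ≤ M`), TAIL by the key inequality (`|⟨φ_i, K φ_i⟩| ≤ √n ρ_i < √(nθ)`).
-/

noncomputable section

-- the tree's namespace `Summit.MatrixMultiplication.MatrixMultiplication.…` repeats a component by design
set_option linter.dupNamespace false

namespace Summit.MatrixMultiplication.MatrixMultiplication.Theorems.DiagonalPowerDecay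

open scoped BigOperators ComplexConjugate ComplexOrder
open Matrix Literature.LinearAlgebra.Matrix
open Literature.Probability.RandomMatrix (nsq nsq_nonneg)

/-! ## The sub-unitary witness of a vector (Schmidt rows via the spectral theorem of `Φ Φᴴ`) -/

section Witness

variable {n : ℕ}

/-- `Ψ ∈ ℂ^n ⊗ ℂ^n` is SUB-UNITARY: the matrix `(m,m') ↦ conj Ψ(m,m')` is a contraction. -/
def IsSubunitary (Ψ : Fin n × Fin n → ℂ) : Prop :=
  ∀ x : Fin n → ℂ, (∑ m, ‖∑ m', conj (Ψ (m, m')) * x m'‖ ^ 2) ≤ nsq x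

/-- `0` is sub-unitary. -/
theorem isSubunitary_zero : IsSubunitary (0 : Fin n × Fin n → ℂ) := by
  intro x; simp [nsq_nonneg]

/-- **Sub-unitary witness.** Every `φ ∈ ℂ^n ⊗ ℂ^n` admits a sub-unitary `Ψ` with `⟨Ψ, φ⟩ = ρ ≥ 0` real and
`nsq ((ptr X) φ) ≤ n ρ²` for every Hermitian contraction `X` (so `ρ` is the sum of the Schmidt coefficients
of `φ`, obtained here from the eigenvector basis of `Φ Φᴴ` without a singular value decomposition). -/
theorem exists_subunitary_witness (φ : Fin n × Fin n → ℂ) :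
    ∃ Ψ : Fin n × Fin n → ℂ, IsSubunitary Ψ ∧ ∃ ρ : ℝ, 0 ≤ ρ ∧
      (∑ x, conj (Ψ x) * φ x) = (ρ : ℂ) ∧
      ∀ X : Matrix (Fin n × Fin n) (Fin n × Fin n) ℂ, X.IsHermitian → IsContr X →
        nsq (ptr X *ᵥ φ) ≤ n * ρ ^ 2 := by
  classical
  -- the Gram matrix of the rows and its eigenvector basis
  set Φ : Matrix (Fin n) (Fin n) ℂ := Matrix.of fun l l' => φ (l, l') with hΦ
  have hG : (Φ * Φᴴ).IsHermitian := Matrix.isHermitian_mul_conjTranspose_self Φ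
  set b : Fin n → Fin n → ℂ := fun j => (⇑(hG.eigenvectorBasis j) : Fin n → ℂ) with hbdef
  have hb : ∀ j k, (∑ μ, conj (b j μ) * b k μ) = if j = k then 1 else 0 := eigvec_orthonormal hG
  have hbc : ∀ w : Fin n → ℂ, w = ∑ j, (∑ μ, conj (b j μ) * w μ) • b j := eigvec_expand hG
  set r : Fin n → Fin n → ℂ := row b φ with hrdef
  -- rows are pairwise orthogonal (eigenvectors of Φ Φᴴ)
  have hGapply : ∀ κ l, (Φ * Φᴴ) κ l = ∑ μ', φ (κ, μ') * conj (φ (l, μ')) := by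
    intro κ l
    simp only [Matrix.mul_apply, Matrix.conjTranspose_apply, RCLike.star_def, hΦ, Matrix.of_apply]
  have hrow_orth : ∀ j k, (∑ μ', conj (r j μ') * r k μ') =
      (hG.eigenvalues k : ℂ) * ∑ κ, conj (b j κ) * b k κ := by
    intro j k
    calc (∑ μ', conj (r j μ') * r k μ')
        = ∑ μ', ∑ l, ∑ κ, b j l * conj (b k κ) * (φ (κ, μ') * conj (φ (l, μ'))) := by
          refine Finset.sum_congr rfl fun μ' _ => ?_
          simp only [hrdef, row, map_sum, map_mul, Complex.conj_conj, Finset.sum_mul]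
          refine Finset.sum_congr rfl fun l _ => ?_
          rw [Finset.mul_sum]
          exact Finset.sum_congr rfl fun κ _ => by ring
      _ = ∑ l, ∑ κ, b j l * conj (b k κ) * (Φ * Φᴴ) κ l := by
          rw [Finset.sum_comm]
          refine Finset.sum_congr rfl fun l _ => ?_
          rw [Finset.sum_comm]
          refine Finset.sum_congr rfl fun κ _ => ?_
          rw [hGapply, Finset.mul_sum]
      _ = ∑ κ, conj (b k κ) * ∑ l, (Φ * Φᴴ) κ l * b j l := by
          rw [Finset.sum_comm]
          refine Finset.sum_congr rfl fun κ _ => ?_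
          rw [Finset.mul_sum]
          exact Finset.sum_congr rfl fun l _ => by ring
      _ = ∑ κ, conj (b k κ) * ((hG.eigenvalues j : ℂ) * b j κ) := by
          refine Finset.sum_congr rfl fun κ _ => ?_
          have h := congrFun (hG.mulVec_eigenvectorBasis j) κ
          simp only [Matrix.mulVec, dotProduct, Pi.smul_apply, Complex.real_smul] at h
          rw [h]
      _ = (hG.eigenvalues j : ℂ) * ∑ κ, conj (b k κ) * b j κ := by
          rw [Finset.mul_sum]; exact Finset.sum_congr rfl fun κ _ => by ring
      _ = (hG.eigenvalues k : ℂ) * ∑ κ, conj (b j κ) * b k κ := by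
          rw [hb k j, hb j k]
          by_cases hjk : j = k
          · subst hjk; simp
          · rw [if_neg (Ne.symm hjk), if_neg hjk, mul_zero, mul_zero]
  -- normalised rows
  set sj : Fin n → ℝ := fun j => Real.sqrt (nsq (r j)) with hsj
  set y : Fin n → Fin n → ℂ := fun j => ((sj j)⁻¹ : ℂ) • r j with hydef
  have hy_orth : ∀ j k, j ≠ k → (∑ μ, conj (y j μ) * y k μ) = 0 := by
    intro j k hjk
    have h0 : (∑ μ', conj (r j μ') * r k μ') = 0 := by rw [hrow_orth, hb, if_neg hjk, mul_zero]
    calc (∑ μ, conj (y j μ) * y k μ) = conj ((sj j)⁻¹ : ℂ) * ((sj k)⁻¹ : ℂ) * ∑ μ', conj (r j μ') * r k μ' := by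
          rw [Finset.mul_sum]
          refine Finset.sum_congr rfl fun μ _ => ?_
          simp only [hydef, Pi.smul_apply, smul_eq_mul, map_mul]
          ring
      _ = 0 := by rw [h0, mul_zero]
  have hy_nsq : ∀ j, nsq (y j) ≤ 1 := by
    intro j
    rw [hydef]
    dsimp only
    rw [nsq_complex_smul, norm_inv, Complex.norm_real, Real.norm_eq_abs, abs_of_nonneg (Real.sqrt_nonneg _)]
    rcases eq_or_lt_of_le (nsq_nonneg (r j)) with h0 | hpos
    · rw [← h0]; simp
    · rw [inv_pow, Real.sq_sqrt hpos.le]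
      exact le_of_eq (inv_mul_cancel₀ hpos.ne')
  -- the witness
  set Ψ : Fin n × Fin n → ℂ := fun x => ∑ j, b j x.1 * y j x.2 with hΨ
  refine ⟨Ψ, ?_, ∑ j, sj j, Finset.sum_nonneg fun j _ => Real.sqrt_nonneg _, ?_, ?_⟩
  · -- sub-unitary
    intro x
    set c : Fin n → ℂ := fun j => ∑ m', conj (y j m') * x m' with hc
    have hcol : ∀ m, (∑ m', conj (Ψ (m, m')) * x m') = (∑ j, c j • fun μ => conj (b j μ)) m := by
      intro m
      simp only [hΨ, Finset.sum_apply, Pi.smul_apply, smul_eq_mul, map_sum, map_mul, Finset.sum_mul, hc]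
      rw [Finset.sum_comm]
      refine Finset.sum_congr rfl fun j _ => ?_
      exact Finset.sum_congr rfl fun m' _ => by ring
    have hbconj : ∀ j k, (∑ μ, conj (conj (b j μ)) * conj (b k μ)) = if j = k then 1 else 0 := by
      intro j k
      rw [show (∑ μ, conj (conj (b j μ)) * conj (b k μ)) = conj (∑ μ, conj (b j μ) * b k μ) by
        rw [map_sum]; exact Finset.sum_congr rfl fun μ _ => by rw [map_mul], hb j k]
      split_ifs <;> simp
    calc (∑ m, ‖∑ m', conj (Ψ (m, m')) * x m'‖ ^ 2) = nsq (∑ j, c j • fun μ => conj (b j μ)) := by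
          unfold nsq; exact Finset.sum_congr rfl fun m _ => by rw [hcol m]
      _ = ∑ j, ‖c j‖ ^ 2 := nsq_sum_smul_of_orthonormal _ hbconj c
      _ ≤ nsq x := bessel_suborthonormal y hy_orth hy_nsq x
  · -- ⟨Ψ, φ⟩ = Σ_j ‖r_j‖
    calc (∑ x, conj (Ψ x) * φ x) = ∑ μ, ∑ μ', ∑ j, conj (y j μ') * (conj (b j μ) * φ (μ, μ')) := by
          rw [Fintype.sum_prod_type]
          refine Finset.sum_congr rfl fun μ _ => Finset.sum_congr rfl fun μ' _ => ?_
          simp only [hΨ, map_sum, map_mul, Finset.sum_mul]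
          exact Finset.sum_congr rfl fun j _ => by ring
      _ = ∑ j, ∑ μ', conj (y j μ') * ∑ μ, conj (b j μ) * φ (μ, μ') := by
          calc (∑ μ, ∑ μ', ∑ j, conj (y j μ') * (conj (b j μ) * φ (μ, μ')))
              = ∑ μ, ∑ j, ∑ μ', conj (y j μ') * (conj (b j μ) * φ (μ, μ')) :=
                Finset.sum_congr rfl fun μ _ => Finset.sum_comm
            _ = ∑ j, ∑ μ, ∑ μ', conj (y j μ') * (conj (b j μ) * φ (μ, μ')) := Finset.sum_comm
            _ = ∑ j, ∑ μ', ∑ μ, conj (y j μ') * (conj (b j μ) * φ (μ, μ')) :=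
                Finset.sum_congr rfl fun j _ => Finset.sum_comm
            _ = _ := Finset.sum_congr rfl fun j _ => Finset.sum_congr rfl fun μ' _ => by rw [Finset.mul_sum]
      _ = ∑ j, ((sj j : ℝ) : ℂ) := by
          refine Finset.sum_congr rfl fun j _ => ?_
          have hrj : ∀ μ', (∑ μ, conj (b j μ) * φ (μ, μ')) = r j μ' := fun μ' => rfl
          simp_rw [hrj]
          calc (∑ μ', conj (y j μ') * r j μ') = conj ((sj j)⁻¹ : ℂ) * ∑ μ', conj (r j μ') * r j μ' := by
                rw [Finset.mul_sum]
                refine Finset.sum_congr rfl fun μ' _ => ?_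
                simp only [hydef, Pi.smul_apply, smul_eq_mul, map_mul]
                ring
            _ = ((sj j : ℝ) : ℂ) := by
                rw [sum_conj_mul_self, ← Complex.ofReal_inv, Complex.conj_ofReal, ← Complex.ofReal_mul]
                congr 1
                rw [hsj]
                dsimp only
                have hs := nsq_nonneg (r j)
                rcases eq_or_lt_of_le hs with h0 | hpos
                · rw [← h0]; simp
                · have hne : Real.sqrt (nsq (r j)) ≠ 0 := (Real.sqrt_pos.mpr hpos).ne'
                  rw [inv_mul_eq_iff_eq_mul₀ hne]
                  exact (Real.mul_self_sqrt hs).symm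
      _ = ((∑ j, sj j : ℝ) : ℂ) := by rw [Complex.ofReal_sum]
  · -- the key inequality
    intro X hXh hXc
    exact nsq_ptr_mulVec_le X hXh hXc b hb hbc φ

end Witness

/-! ## The trace-norm bound for the partial transpose of a positive semidefinite operator -/

section Bound

variable {n : ℕ}

/-- **Trace-norm bound.** Let `R ⪰ 0` on `ℂ^n ⊗ ℂ^n` and suppose `Re ⟨Ψ, R Ψ⟩ ≤ M` for every sub-unitary `Ψ`.
Then for every `θ > 0` the partial transpose splits as `ptr R = Y − Z` with `Y, Z ⪰ 0` and
`tr Y + tr Z ≤ n √(t M / θ) + t √(n θ)`, `t = tr R`. (Optimising `θ` gives `‖(ptr R)‖₁⁴ ≤ 16 n³ t³ M`.) -/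
theorem ptr_traceNorm_bound (R : Matrix (Fin n × Fin n) (Fin n × Fin n) ℂ) (hR : R.PosSemidef) {M θ : ℝ}
    (hθ : 0 < θ) (hM : ∀ Ψ : Fin n × Fin n → ℂ, IsSubunitary Ψ → (star Ψ ⬝ᵥ (R *ᵥ Ψ)).re ≤ M) :
    ∃ Y Z : Matrix (Fin n × Fin n) (Fin n × Fin n) ℂ, Y.PosSemidef ∧ Z.PosSemidef ∧ ptr R = Y - Z ∧
      (Y.trace + Z.trace).re ≤ n * Real.sqrt (R.trace.re * M / θ) + R.trace.re * Real.sqrt (n * θ) := by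
  classical
  have hM0 : 0 ≤ M := by
    have h := hM 0 isSubunitary_zero
    simpa using h
  have hH : (ptr R).IsHermitian := ptr_isHermitian hR.1
  obtain ⟨Y, Z, hY, hZ, hsplit, htr⟩ := hermitian_exists_jordan hH
  refine ⟨Y, Z, hY, hZ, hsplit, ?_⟩
  rw [htr, hermitian_sum_abs_eigenvalues_eq hH, sum_sign_quadform_eq_trace hH]
  -- notation
  set X := signOp hH with hXdef
  set K := ptr X with hKdef
  have hXh : X.IsHermitian := signOp_isHermitian hH
  have hXc : IsContr X := signOp_isContr hH
  set μ := hR.1.eigenvalues with hμ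
  set φ := fun i => (⇑(hR.1.eigenvectorBasis i) : Fin n × Fin n → ℂ) with hφ
  have hμnn : ∀ i, 0 ≤ μ i := hR.eigenvalues_nonneg
  have horth := eigvec_orthonormal hR.1
  set t := R.trace.re with ht
  have htsum : t = ∑ i, μ i := psd_re_trace_eq_sum_eigenvalues hR
  -- T_i := ⟨φ_i, K φ_i⟩ and the expansion of tr(R K) along the eigenvectors of R
  set T : Fin n × Fin n → ℂ := fun i => star (φ i) ⬝ᵥ (K *ᵥ φ i) with hT
  have hexpand : (∑ p, ∑ q, R p q * K q p) = ∑ i, (μ i : ℂ) * T i := by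
    calc (∑ p, ∑ q, R p q * K q p)
        = ∑ p, ∑ q, ∑ i, (μ i : ℂ) * (conj (φ i q) * (K q p * φ i p)) := by
          refine Finset.sum_congr rfl fun p _ => Finset.sum_congr rfl fun q _ => ?_
          rw [hermitian_apply_eq_sum_eigen hR.1 p q, Finset.sum_mul]
          exact Finset.sum_congr rfl fun i _ => by ring
      _ = ∑ p, ∑ i, ∑ q, (μ i : ℂ) * (conj (φ i q) * (K q p * φ i p)) :=
          Finset.sum_congr rfl fun p _ => Finset.sum_comm
      _ = ∑ i, ∑ p, ∑ q, (μ i : ℂ) * (conj (φ i q) * (K q p * φ i p)) := Finset.sum_comm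
      _ = ∑ i, (μ i : ℂ) * T i := by
          refine Finset.sum_congr rfl fun i _ => ?_
          rw [hT]
          dsimp only
          rw [dotProduct, Finset.mul_sum, Finset.sum_comm]
          refine Finset.sum_congr rfl fun q _ => ?_
          rw [Pi.star_apply, RCLike.star_def, Matrix.mulVec, dotProduct, Finset.mul_sum, Finset.mul_sum]
  rw [hexpand]
  -- the witnesses Ψ_i, ρ_i
  have hw : ∀ i, ∃ Ψ : Fin n × Fin n → ℂ, IsSubunitary Ψ ∧ ∃ ρ : ℝ, 0 ≤ ρ ∧
      (∑ x, conj (Ψ x) * φ i x) = (ρ : ℂ) ∧ nsq (K *ᵥ φ i) ≤ n * ρ ^ 2 := by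
    intro i
    obtain ⟨Ψ, hΨ, ρ, hρ, hov, hkey⟩ := exists_subunitary_witness (φ i)
    exact ⟨Ψ, hΨ, ρ, hρ, hov, hkey X hXh hXc⟩
  choose Ψ hΨ ρ hρ hov hkey using hw
  -- (a) |T_i| ≤ √n ρ_i
  have hTi : ∀ i, ‖T i‖ ≤ Real.sqrt n * ρ i := by
    intro i
    have hcs := norm_sum_conj_mul_sq_le (φ i) (K *ᵥ φ i)
    have hn1 : nsq (φ i) = 1 := eigvec_normSq hR.1 i
    rw [hn1, one_mul] at hcs
    have hT' : T i = ∑ x, conj (φ i x) * (K *ᵥ φ i) x := by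
      rw [hT]; dsimp only; rw [dotProduct]
      exact Finset.sum_congr rfl fun x _ => by rw [Pi.star_apply, RCLike.star_def]
    rw [hT']
    have h1 : ‖∑ x, conj (φ i x) * (K *ᵥ φ i) x‖ ≤ Real.sqrt (nsq (K *ᵥ φ i)) := by
      rw [← Real.sqrt_sq (norm_nonneg _)]
      exact Real.sqrt_le_sqrt hcs
    refine h1.trans ?_
    rw [← Real.sqrt_sq (hρ i), ← Real.sqrt_mul (Nat.cast_nonneg n)]
    exact Real.sqrt_le_sqrt (hkey i)
  -- (b) μ_i ρ_i² ≤ M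
  have hμρ : ∀ i, μ i * ρ i ^ 2 ≤ M := by
    intro i
    have h1 := psd_eigen_term_le hR (Ψ i) i
    have h2 : ‖∑ x, conj (φ i x) * Ψ i x‖ = ρ i := by
      have : (∑ x, conj (φ i x) * Ψ i x) = conj (∑ x, conj (Ψ i x) * φ i x) := by
        rw [map_sum]; exact Finset.sum_congr rfl fun x _ => by rw [map_mul, Complex.conj_conj, mul_comm]
      rw [this, hov i, Complex.conj_ofReal, Complex.norm_real, Real.norm_eq_abs, abs_of_nonneg (hρ i)]
    simp only [hμ, hφ] at h1 h2 ⊢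
    rw [h2] at h1
    exact h1.trans (hM (Ψ i) (hΨ i))
  -- split the index set
  set P : Fin n × Fin n → Prop := fun i => θ ≤ ρ i ^ 2 with hP
  set Λ := Finset.univ.filter P with hΛ
  rw [Complex.re_sum, ← Finset.sum_filter_add_sum_filter_not Finset.univ P]
  have hre_i : ∀ i, ((μ i : ℂ) * T i).re = μ i * (T i).re := fun i => by
    rw [Complex.re_ofReal_mul]
  -- TAIL
  have htail : (∑ i ∈ Finset.univ.filter (fun i => ¬ P i), ((μ i : ℂ) * T i).re) ≤ t * Real.sqrt (n * θ) := by
    calc (∑ i ∈ Finset.univ.filter (fun i => ¬ P i), ((μ i : ℂ) * T i).re)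
        ≤ ∑ i ∈ Finset.univ.filter (fun i => ¬ P i), μ i * Real.sqrt (n * θ) := by
          refine Finset.sum_le_sum fun i hi => ?_
          rw [Finset.mem_filter] at hi
          rw [hre_i]
          refine mul_le_mul_of_nonneg_left ?_ (hμnn i)
          refine (Complex.re_le_norm _).trans ((hTi i).trans ?_)
          rw [Real.sqrt_mul (Nat.cast_nonneg n)]
          refine mul_le_mul_of_nonneg_left ?_ (Real.sqrt_nonneg _)
          rw [← Real.sqrt_sq (hρ i)]
          exact Real.sqrt_le_sqrt (le_of_lt (lt_of_not_ge hi.2))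
      _ ≤ ∑ i, μ i * Real.sqrt (n * θ) :=
          Finset.sum_le_sum_of_subset_of_nonneg (Finset.filter_subset _ _)
            (fun i _ _ => mul_nonneg (hμnn i) (Real.sqrt_nonneg _))
      _ = t * Real.sqrt (n * θ) := by rw [← Finset.sum_mul, ← htsum]
  -- HEAD
  have hhead : (∑ i ∈ Λ, ((μ i : ℂ) * T i).re) ≤ n * Real.sqrt (t * M / θ) := by
    -- as one trace against R_Λ
    set RΛ : (Fin n × Fin n) → (Fin n × Fin n) → ℂ :=
      fun p q => ∑ i ∈ Λ, (μ i : ℂ) * (φ i p * conj (φ i q)) with hRΛ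
    have hsumT : (∑ i ∈ Λ, (μ i : ℂ) * T i) = ∑ q, ∑ p, K q p * RΛ p q := by
      symm
      calc (∑ q, ∑ p, K q p * RΛ p q) = ∑ q, ∑ p, ∑ i ∈ Λ, (μ i : ℂ) * (conj (φ i q) * (K q p * φ i p)) := by
            refine Finset.sum_congr rfl fun q _ => Finset.sum_congr rfl fun p _ => ?_
            rw [hRΛ]; dsimp only; rw [Finset.mul_sum]
            exact Finset.sum_congr rfl fun i _ => by ring
        _ = ∑ q, ∑ i ∈ Λ, ∑ p, (μ i : ℂ) * (conj (φ i q) * (K q p * φ i p)) :=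
            Finset.sum_congr rfl fun q _ => Finset.sum_comm
        _ = ∑ i ∈ Λ, ∑ q, ∑ p, (μ i : ℂ) * (conj (φ i q) * (K q p * φ i p)) := Finset.sum_comm
        _ = ∑ i ∈ Λ, (μ i : ℂ) * T i := by
            refine Finset.sum_congr rfl fun i _ => ?_
            rw [hT]; dsimp only
            rw [dotProduct, Finset.mul_sum]
            refine Finset.sum_congr rfl fun q _ => ?_
            rw [Pi.star_apply, RCLike.star_def, Matrix.mulVec, dotProduct, Finset.mul_sum, Finset.mul_sum]
    -- Cauchy–Schwarz over the pair index
    have hKfrob : (∑ q, ∑ p, ‖K q p‖ ^ 2) ≤ (n : ℝ) ^ 2 := by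
      have h1 : (∑ q, ∑ p, ‖K q p‖ ^ 2) = ∑ x : Fin n × Fin n, ∑ y : Fin n × Fin n, ‖X x y‖ ^ 2 := by
        rw [hKdef, sum_sum_ptr_reindex (F := fun q p => ‖ptr X q p‖ ^ 2)]
        rfl
      rw [h1]
      refine (frob_le_card_of_isContr X hXc).trans (le_of_eq ?_)
      simp [Fintype.card_prod, Fintype.card_fin, sq]
    have hRfrob : (∑ p, ∑ q, ‖RΛ p q‖ ^ 2) = ∑ i ∈ Λ, μ i ^ 2 := frob_partial_eigen hR.1 Λ
    have hμle : ∀ i ∈ Λ, μ i ≤ M / θ := by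
      intro i hi
      rw [hΛ, Finset.mem_filter] at hi
      rw [le_div_iff₀ hθ]
      calc μ i * θ ≤ μ i * ρ i ^ 2 := mul_le_mul_of_nonneg_left hi.2 (hμnn i)
        _ ≤ M := hμρ i
    have hsumsq : (∑ i ∈ Λ, μ i ^ 2) ≤ t * M / θ := by
      calc (∑ i ∈ Λ, μ i ^ 2) ≤ ∑ i ∈ Λ, μ i * (M / θ) :=
            Finset.sum_le_sum fun i hi => by rw [sq]; exact mul_le_mul_of_nonneg_left (hμle i hi) (hμnn i)
        _ ≤ ∑ i, μ i * (M / θ) :=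
            Finset.sum_le_sum_of_subset_of_nonneg (Finset.filter_subset _ _)
              (fun i _ _ => mul_nonneg (hμnn i) (div_nonneg hM0 hθ.le))
        _ = t * M / θ := by rw [← Finset.sum_mul, ← htsum]; ring
    -- |Σ_{q,p} K q p RΛ p q| ≤ ‖K‖_F ‖RΛ‖_F
    have hcs : ‖∑ q, ∑ p, K q p * RΛ p q‖ ^ 2 ≤ (∑ q, ∑ p, ‖K q p‖ ^ 2) * ∑ p, ∑ q, ‖RΛ p q‖ ^ 2 := by
      have h := norm_sum_conj_mul_sq_le (fun z : (Fin n × Fin n) × (Fin n × Fin n) => conj (K z.1 z.2))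
        (fun z => RΛ z.2 z.1)
      have hl : (∑ z : (Fin n × Fin n) × (Fin n × Fin n), conj (conj (K z.1 z.2)) * RΛ z.2 z.1) =
          ∑ q, ∑ p, K q p * RΛ p q := by
        rw [Fintype.sum_prod_type]
        exact Finset.sum_congr rfl fun q _ => Finset.sum_congr rfl fun p _ => by rw [Complex.conj_conj]
      have h2 : nsq (fun z : (Fin n × Fin n) × (Fin n × Fin n) => conj (K z.1 z.2)) = ∑ q, ∑ p, ‖K q p‖ ^ 2 := by
        unfold nsq; rw [Fintype.sum_prod_type]; try simp_rw [Complex.norm_conj]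
      have h3 : nsq (fun z : (Fin n × Fin n) × (Fin n × Fin n) => RΛ z.2 z.1) = ∑ p, ∑ q, ‖RΛ p q‖ ^ 2 := by
        unfold nsq; rw [Fintype.sum_prod_type, Finset.sum_comm]
      rw [hl, h2, h3] at h
      exact h
    calc (∑ i ∈ Λ, ((μ i : ℂ) * T i).re) = (∑ i ∈ Λ, (μ i : ℂ) * T i).re := by rw [Complex.re_sum]
      _ ≤ ‖∑ i ∈ Λ, (μ i : ℂ) * T i‖ := Complex.re_le_norm _
      _ = ‖∑ q, ∑ p, K q p * RΛ p q‖ := by rw [hsumT]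
      _ ≤ Real.sqrt ((∑ q, ∑ p, ‖K q p‖ ^ 2) * ∑ p, ∑ q, ‖RΛ p q‖ ^ 2) := by
          rw [← Real.sqrt_sq (norm_nonneg _)]
          exact Real.sqrt_le_sqrt hcs
      _ ≤ Real.sqrt ((n : ℝ) ^ 2 * (t * M / θ)) := by
          refine Real.sqrt_le_sqrt ?_
          rw [hRfrob]
          exact mul_le_mul hKfrob hsumsq (Finset.sum_nonneg fun i _ => sq_nonneg _) (sq_nonneg _)
      _ = n * Real.sqrt (t * M / θ) := by
          rw [Real.sqrt_mul (sq_nonneg _), Real.sqrt_sq (Nat.cast_nonneg n)]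
  linarith [hhead, htail]

end Bound
/-- **Trace-norm bound, unfolded statement (registered sub-goal `ptrTraceNormBound`).** For `R ⪰ 0` on `ℂ^n ⊗ ℂ^n`
with `Re⟨Ψ, RΨ⟩ ≤ M` for every sub-unitary `Ψ`, and every `θ > 0`, the partial transpose splits as `Y − Z`, `Y, Z ⪰ 0`,
with `tr Y + tr Z ≤ n √(t M/θ) + t √(n θ)`, `t = tr R`. -/
theorem ptrTraceNormBound {n : ℕ} (R : Matrix (Fin n × Fin n) (Fin n × Fin n) ℂ) (hR : R.PosSemidef) {M θ : ℝ}
    (hθ : 0 < θ)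
    (hM : ∀ Ψ : Fin n × Fin n → ℂ,
      (∀ x : Fin n → ℂ, (∑ m, ‖∑ m', conj (Ψ (m, m')) * x m'‖ ^ 2) ≤ ∑ m, ‖x m‖ ^ 2) →
      (star Ψ ⬝ᵥ (R.mulVec Ψ)).re ≤ M) :
    ∃ Y Z : Matrix (Fin n × Fin n) (Fin n × Fin n) ℂ, Y.PosSemidef ∧ Z.PosSemidef ∧
      (Matrix.of fun x y : Fin n × Fin n => R (x.1, y.2) (y.1, x.2)) = Y - Z ∧
      (Y.trace + Z.trace).re ≤ n * Real.sqrt (R.trace.re * M / θ) + R.trace.re * Real.sqrt (n * θ) :=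
  ptr_traceNorm_bound R hR hθ hM

end Summit.MatrixMultiplication.MatrixMultiplication.Theorems.DiagonalPowerDecay

end
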